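import Summits.HodgeConjecture.CorCM.Census.QuarticInversionBlocks

/-!
# The quartic inversion twists, XXII: ten (`ζ = 1`) resp. twelve (`ζ = 0`) residual blocks

COR-CM (cell `pub-hodgecm2`, stage 2 of the Hodge ladder), count-neutral KERNEL COMBINATORICS by the binder seat b23 (gen 44; claim
QUARTIC-INVERSION, HOME/INBOX.md l.12829).  Part XXII of the lane `Census/QuarticInversion*`, on top of part XXI, all BY NAME.  Bookkeeping
definitions with bodies (the residual labels `kLab`, `aLab`, the index maps `kpat`, `repTen`, `repTwelve`) + theorems; `decide` only on
closed Boolean statements over at most six Boolean literals (distinct signatures), no certificate, no named fact, no geometry, no `sorry`.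
`Interfaces.lean` (C1), every E term, B01, `Transposition/*`, `PortJoin/*` untouched.
HONEST FRAMING: `HC_CM` is NOT proved, here or anywhere in the tree; nothing here is a period, a count of record or a headline.

CONTENT (`|B|` odd `≥ 3`, square class `ζ`).  The residual blocks (potential `≤ 1`) are NOT reached by the descent of part VI; the count of
part XXIII needs lower bounds for their number:
* §1 the constant labels `kLab b` (potential `0`) and the atom labels `aLab b` (`δ 0` in coordinate `0`, constants elsewhere; potential `1`),
  their class vectors, half vectors and invariant vectors (part XXI);
* §2 **at least ten residual blocks** for every `ζ` (`ten_le_card_residual`: eight atom labels with distinct signatures and two constants of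
  distinct parity) and **at least twelve for `ζ = 0`** (`twelve_le_card_residual`: two more constants, separated by the `ζ = 0` invariant).
  (Numerically these bounds are equalities: `q30.out`, `q31.out` of this folder.)  All [folklore].

## References
* [Pohlmann1968] H. Pohlmann, Algebraic cycles on abelian varieties of complex multiplication type, Ann. of Math. 88 (1968), Thm 1.
-/

namespace Summit.HodgeConjecture.CorCM.Census.QuarticInversion

open Finset
open Summit.HodgeConjecture.CorCM.Census.OddSliceFacesModel
open Summit.HodgeConjecture.CorCM.Census.OddSliceFacesSquares (clsTy)
open Summit.HodgeConjecture.CorCM.Census.OddSliceFacesDescent (wt_zero wt_delta)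

noncomputable section

variable (A : Type) [AddCommGroup A] [Fintype A] [DecidableEq A] (ζ : ZMod 2)

/-! ## §1 Constant labels and atom labels -/

/-- **The constant label** with halves `b`. [folklore] -/
def kLab (b : Fin 4 → Bool) : Ty₄ A := ((kb A (b 0), kb A (b 1)), (kb A (b 2), kb A (b 3)))

/-- **The atom label**: `δ 0` in coordinate `0`, constants with halves `b` elsewhere. [folklore] -/
def aLab (b : Fin 4 → Bool) : Ty₄ A := ((δ A 0, kb A (b 1)), (kb A (b 2), kb A (b 3)))

omit [AddCommGroup A] [DecidableEq A] in
/-- Constants have class `0`. [folklore] -/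
theorem clsTy_kb (x : Bool) : clsTy A (kb A x) = 0 := by
  unfold clsTy
  cases x
  · rw [show kb A false = 1 from rfl, wt_one]; simp
  · rw [show kb A true = 0 from rfl, wt_zero]; simp

omit [AddCommGroup A] in
/-- A one-element slice has class `1` (`|B| ≥ 2`). [folklore] -/
theorem clsTy_delta (h2 : 2 ≤ Fintype.card A) (u : A) : clsTy A (δ A u) = 1 := by
  unfold clsTy; rw [wt_delta]; omega

omit [AddCommGroup A] [Fintype A] [DecidableEq A] in
/-- The coordinates of a constant label. [folklore] -/
theorem coord_kLab (b : Fin 4 → Bool) (n : Fin 4) : coord A n (kLab A b) = kb A (b n) := by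
  fin_cases n <;> rfl

omit [AddCommGroup A] [DecidableEq A] in
/-- The potential of a constant label is `0`. [folklore] -/
theorem pot₄_kLab (b : Fin 4 → Bool) : pot₄ A (kLab A b) = 0 := by
  rw [pot₄_eq_sum]; simp only [coord_kLab, clsTy_kb, Finset.sum_const_zero]

omit [AddCommGroup A] [DecidableEq A] in
/-- The class vector of a constant label vanishes. [folklore] -/
theorem cl_kLab (b : Fin 4 → Bool) : cl A (kLab A b) = fun _ => false := by
  funext n; simp only [cl, coord_kLab, clsTy_kb]; decide

omit [AddCommGroup A] [DecidableEq A] in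
/-- The half vector of a constant label is `b` (`|B| ≥ 1`). [folklore] -/
theorem hv_kLab (h1 : 1 ≤ Fintype.card A) (b : Fin 4 → Bool) : hv A (kLab A b) = b := by
  funext n; simp only [hv, coord_kLab, half_kb A h1]

omit [AddCommGroup A] [DecidableEq A] in
/-- **The invariant vector of a constant label.** [folklore] -/
theorem inv_kLab (h1 : 1 ≤ Fintype.card A) (b : Fin 4 → Bool) : inv A ζ (kLab A b) = (0, sigAll ζ (fun _ => false) b) := by
  unfold inv sig; rw [pot₄_kLab, cl_kLab, hv_kLab A h1]

omit [Fintype A] in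
/-- The coordinates of an atom label. [folklore] -/
theorem coord_aLab (b : Fin 4 → Bool) (n : Fin 4) : coord A n (aLab A b) = if n = 0 then δ A 0 else kb A (b n) := by
  fin_cases n <;> rfl

/-- The potential of an atom label is `1` (`|B| ≥ 2`). [folklore] -/
theorem pot₄_aLab (h2 : 2 ≤ Fintype.card A) (b : Fin 4 → Bool) : pot₄ A (aLab A b) = 1 := by
  show clsTy A (δ A 0) + clsTy A (kb A (b 1)) + clsTy A (kb A (b 2)) + clsTy A (kb A (b 3)) = 1
  rw [clsTy_delta A h2, clsTy_kb, clsTy_kb, clsTy_kb]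

/-- The class vector of an atom label. [folklore] -/
theorem cl_aLab (h2 : 2 ≤ Fintype.card A) (b : Fin 4 → Bool) : cl A (aLab A b) = fun n => decide (n = 0) := by
  funext n
  simp only [cl, coord_aLab]
  by_cases hn : n = 0
  · rw [if_pos hn, clsTy_delta A h2]; simp [hn]
  · rw [if_neg hn, clsTy_kb]; simp [hn]

/-- The half vector of an atom label (`|B| ≥ 2`). [folklore] -/
theorem hv_aLab (h2 : 2 ≤ Fintype.card A) (b : Fin 4 → Bool) : hv A (aLab A b) = fun n => if n = 0 then true else b n := by
  funext n
  simp only [hv, coord_aLab]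
  by_cases hn : n = 0
  · rw [if_pos hn, if_pos hn, half_delta A h2]
  · rw [if_neg hn, if_neg hn, half_kb A (by omega)]

/-- **The invariant vector of an atom label.** [folklore] -/
theorem inv_aLab (h2 : 2 ≤ Fintype.card A) (b : Fin 4 → Bool) :
    inv A ζ (aLab A b) = (1, sigAll ζ (fun n => decide (n = 0)) (fun n => if n = 0 then true else b n)) := by
  unfold inv sig; rw [pot₄_aLab A h2, cl_aLab A h2, hv_aLab A h2]

/-! ## §2 Ten resp. twelve residual blocks -/

/-- Four constant half vectors with the four values of (parity, `ζ = 0` invariant). [folklore] -/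
def kpat (p k : Bool) : Fin 4 → Bool :=
  if p then (if k then ![false, true, false, false] else ![false, false, false, true])
  else (if k then ![false, false, true, true] else ![false, false, false, false])

omit [AddCommGroup A] [Fintype A] [DecidableEq A] in
/-- **The eight atom labels have distinct signatures.** [folklore] -/
theorem sig_aLab_inj (hζ : ζ = 0 ∨ ζ = 1) {x y z x' y' z' : Bool}
    (h : sigAll ζ (fun n => decide (n = 0)) (fun n => if n = 0 then true else (![false, x, y, z] : Fin 4 → Bool) n) =
      sigAll ζ (fun n => decide (n = 0)) (fun n => if n = 0 then true else (![false, x', y', z'] : Fin 4 → Bool) n)) :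
    (x, y, z) = (x', y', z') := by
  rcases hζ with rfl | rfl
  · revert x y z x' y' z'; decide
  · revert x y z x' y' z'; decide

omit [AddCommGroup A] [Fintype A] [DecidableEq A] in
/-- **The two constants `kpat p false` have distinct signatures** (parity). [folklore] -/
theorem sig_kpat_inj (hζ : ζ = 0 ∨ ζ = 1) {p p' : Bool}
    (h : sigAll ζ (fun _ => false) (kpat p false) = sigAll ζ (fun _ => false) (kpat p' false)) : p = p' := by
  rcases hζ with rfl | rfl
  · revert p p'; decide
  · revert p p'; decide

omit [AddCommGroup A] [Fintype A] [DecidableEq A] in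
/-- **The four constants `kpat p k` have distinct signatures for `ζ = 0`.** [folklore] -/
theorem sig_kpat_inj_zero {p k p' k' : Bool} (h : sigAll 0 (fun _ => false) (kpat p k) = sigAll 0 (fun _ => false) (kpat p' k')) :
    (p, k) = (p', k') := by
  revert p k p' k'; decide

/-- **At least ten residual blocks**, for every `ζ` (`|B|` odd `≥ 3`): eight atom blocks and two constant blocks. [folklore] -/
theorem ten_le_card_residual (hA : Odd (Fintype.card A)) (h2 : 2 ≤ Fintype.card A) :
    10 ≤ (univ.filter fun B : Block A ζ => potB A ζ B ≤ 1).card := by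
  have h01 : ∀ z : ZMod 2, z = 0 ∨ z = 1 := by decide
  have h1 : 1 ≤ Fintype.card A := by omega
  let f : (Bool × Bool × Bool) ⊕ Bool → {B : Block A ζ // potB A ζ B ≤ 1} := fun i =>
    match i with
    | Sum.inl ⟨x, y, z⟩ => ⟨blk A ζ (aLab A ![false, x, y, z]), by rw [potB_blk, pot₄_aLab A h2]⟩
    | Sum.inr p => ⟨blk A ζ (kLab A (kpat p false)), by rw [potB_blk, pot₄_kLab]; exact Nat.zero_le 1⟩
  have hf : Function.Injective f := by
    rintro (⟨x, y, z⟩ | p) (⟨x', y', z'⟩ | p') hii' <;> have hb := inv_eq_of_blk_eq A ζ hA (congrArg Subtype.val hii')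
    · rw [inv_aLab A ζ h2, inv_aLab A ζ h2, Prod.mk.injEq] at hb
      rw [sig_aLab_inj ζ (h01 ζ) hb.2]
    · rw [inv_aLab A ζ h2, inv_kLab A ζ h1, Prod.mk.injEq] at hb
      exact absurd hb.1 one_ne_zero
    · rw [inv_kLab A ζ h1, inv_aLab A ζ h2, Prod.mk.injEq] at hb
      exact absurd hb.1.symm one_ne_zero
    · rw [inv_kLab A ζ h1, inv_kLab A ζ h1, Prod.mk.injEq] at hb
      rw [sig_kpat_inj ζ (h01 ζ) hb.2]
  have hcard := Fintype.card_le_of_injective f hf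
  rw [Fintype.card_subtype] at hcard
  simpa using hcard

/-- **At least twelve residual blocks for `ζ = 0`** (`|B|` odd `≥ 3`): eight atom blocks and four constant blocks. [folklore] -/
theorem twelve_le_card_residual (hA : Odd (Fintype.card A)) (h2 : 2 ≤ Fintype.card A) :
    12 ≤ (univ.filter fun B : Block A 0 => potB A 0 B ≤ 1).card := by
  have h1 : 1 ≤ Fintype.card A := by omega
  let f : (Bool × Bool × Bool) ⊕ (Bool × Bool) → {B : Block A 0 // potB A 0 B ≤ 1} := fun i =>
    match i with
    | Sum.inl ⟨x, y, z⟩ => ⟨blk A 0 (aLab A ![false, x, y, z]), by rw [potB_blk, pot₄_aLab A h2]⟩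
    | Sum.inr ⟨p, k⟩ => ⟨blk A 0 (kLab A (kpat p k)), by rw [potB_blk, pot₄_kLab]; exact Nat.zero_le 1⟩
  have hf : Function.Injective f := by
    rintro (⟨x, y, z⟩ | ⟨p, k⟩) (⟨x', y', z'⟩ | ⟨p', k'⟩) hii' <;> have hb := inv_eq_of_blk_eq A 0 hA (congrArg Subtype.val hii')
    · rw [inv_aLab A 0 h2, inv_aLab A 0 h2, Prod.mk.injEq] at hb
      rw [sig_aLab_inj 0 (Or.inl rfl) hb.2]
    · rw [inv_aLab A 0 h2, inv_kLab A 0 h1, Prod.mk.injEq] at hb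
      exact absurd hb.1 one_ne_zero
    · rw [inv_kLab A 0 h1, inv_aLab A 0 h2, Prod.mk.injEq] at hb
      exact absurd hb.1.symm one_ne_zero
    · rw [inv_kLab A 0 h1, inv_kLab A 0 h1, Prod.mk.injEq] at hb
      rw [sig_kpat_inj_zero hb.2]
  have hcard := Fintype.card_le_of_injective f hf
  rw [Fintype.card_subtype] at hcard
  simpa using hcard

end

end Summit.HodgeConjecture.CorCM.Census.QuarticInversion
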